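import Literature.Computability.QuantumComplexity.RevSLPMul
import HarnessLib

/-!
# Reversible arithmetic gadgets, IV: the exact interpreter (no truncation) and when it agrees

Topic `Literature/Computability/QuantumComplexity`; sequel of `RevSLP.lean`/`RevSLPSteps.lean`/
`RevSLPMul.lean`. The interpreter `SLP.run` truncates sums to `Wd` bits (`add d a b sh :=
(a + b·2^{sh}) mod 2^{Wd}`), as the circuit does. Concrete predicate programs are easier to evaluate
with the **exact interpreter** `SLP.runExact` (no truncation anywhere) and a separate overflow check:
`SLP.run_eq_runExact` — if along the exact run every register value stays below `2^{Wd}`, the two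
interpreters agree (registers and flags). Also: `SLP.runExact_append`, the exact semantics of the
multiplication macro (`SLP.runExact_mulInstrs`), and monotone bookkeeping of which registers/flags a
program may change (`SLP.runExact_regs_of_not_mem`, `SLP.runExact_flags_of_not_mem`).

## References

* V. Vedral, A. Barenco, A. Ekert, Phys. Rev. A 54 (1996), §3 [VedralBarencoEkert1996].
-/

namespace Literature.Computability.QuantumComplexity

namespace SLP

open Function

variable (inp : ℕ)

/-- **One exact step** (no truncation): `copyIn d off len := inp/2^{off} mod 2^{len}`, `setBit d i := 2^i`,
`add d a b sh := a + b·2^{sh}`, `andBit d x i y := [x_i]·y`, flags as in `step`. [folklore] -/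
def stepExact (st : State) : Instr → State
  | .copyIn d off len => { st with regs := update st.regs d (inp / 2 ^ off % 2 ^ len) }
  | .setBit d i => { st with regs := update st.regs d (2 ^ i) }
  | .add d a b sh => { st with regs := update st.regs d (st.regs a + st.regs b * 2 ^ sh) }
  | .andBit d x i y => { st with regs := update st.regs d (if (st.regs x).testBit i then st.regs y else 0) }
  | .lt f a b => { st with flags := update st.flags f (decide (st.regs a < st.regs b)) }
  | .fnot f g => { st with flags := update st.flags f (!st.flags g) }
  | .fand f g h => { st with flags := update st.flags f (st.flags g && st.flags h) }
  | .forr f g h => { st with flags := update st.flags f (st.flags g || st.flags h) }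

/-- **The exact run.** [folklore] -/
def runExact (st : State) : List Instr → State
  | [] => st
  | ins :: p => runExact (stepExact inp st ins) p

/-- Exact run of a concatenation. [folklore] -/
theorem runExact_append (st : State) (p q : List Instr) :
    runExact inp st (p ++ q) = runExact inp (runExact inp st p) q := by
  induction p generalizing st with
  | nil => rfl
  | cons i p ih => exact ih _

/-- **Bounded exact runs are truncated runs.** If every prefix of the exact run keeps all registers
below `2^{Wd}` (it suffices to check the written register after each instruction, the others being
unchanged), and `setBit` is only used with `i < Wd`, then `run` and `runExact` agree. [folklore] -/
theorem run_eq_runExact (Wd : ℕ) : ∀ (p : List Instr) (st : State),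
    (∀ ins ∈ p, ∀ d i, ins = .setBit d i → i < Wd) →
    (∀ p₁ p₂, p = p₁ ++ p₂ → ∀ ρ, (runExact inp st p₁).regs ρ < 2 ^ Wd) →
    run Wd inp st p = runExact inp st p
  | [], _, _, _ => rfl
  | ins :: p, st, hset, hb => by
    have hb0 : ∀ ρ, st.regs ρ < 2 ^ Wd := hb [] (ins :: p) rfl
    have hb1 : ∀ ρ, (stepExact inp st ins).regs ρ < 2 ^ Wd := hb [ins] p rfl
    have hstep : step Wd inp st ins = stepExact inp st ins := by
      cases ins with
      | copyIn d off len =>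
        have := hb1 d; simp only [stepExact, update_self] at this
        simp only [step, stepExact, Nat.mod_eq_of_lt this]
      | setBit d i => simp only [step, stepExact, if_pos (hset _ (by simp) d i rfl)]
      | add d a b sh =>
        have := hb1 d; simp only [stepExact, update_self] at this
        simp only [step, stepExact, Nat.mod_eq_of_lt this]
      | andBit d x i y => rfl
      | lt f a b => rfl
      | fnot f g => rfl
      | fand f g h => rfl
      | forr f g h => rfl
    rw [run, runExact, hstep]
    exact run_eq_runExact Wd p _ (fun i hi => hset i (by simp [hi])) (fun p₁ p₂ e ρ => hb (ins :: p₁) p₂ (by rw [e]; rfl) ρ)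

/-- A register not written by an exact run keeps its value. [folklore] -/
theorem runExact_regs_of_not_mem {d : ℕ} : ∀ (p : List Instr) (st : State), d ∉ p.filterMap Instr.rdest →
    (runExact inp st p).regs d = st.regs d
  | [], _, _ => rfl
  | ins :: p, st, hd => by
    have hd' : d ∉ p.filterMap Instr.rdest := fun h => hd (by
      cases h' : ins.rdest with
      | none => rw [List.filterMap_cons_none h']; exact h
      | some d' => rw [List.filterMap_cons_some h']; exact List.mem_cons_of_mem _ h)
    rw [runExact, runExact_regs_of_not_mem p _ hd']
    cases ins with
    | copyIn d' o l => exact update_of_ne (fun e => hd (by subst e; simp [Instr.rdest])) _ _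
    | setBit d' i => exact update_of_ne (fun e => hd (by subst e; simp [Instr.rdest])) _ _
    | add d' a b sh => exact update_of_ne (fun e => hd (by subst e; simp [Instr.rdest])) _ _
    | andBit d' x i y => exact update_of_ne (fun e => hd (by subst e; simp [Instr.rdest])) _ _
    | lt f a b => rfl
    | fnot f g => rfl
    | fand f g h => rfl
    | forr f g h => rfl

/-- A flag not written by an exact run keeps its value. [folklore] -/
theorem runExact_flags_of_not_mem {f : ℕ} : ∀ (p : List Instr) (st : State), f ∉ p.filterMap Instr.fdest →
    (runExact inp st p).flags f = st.flags f
  | [], _, _ => rfl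
  | ins :: p, st, hf => by
    have hf' : f ∉ p.filterMap Instr.fdest := fun h => hf (by
      cases h' : ins.fdest with
      | none => rw [List.filterMap_cons_none h']; exact h
      | some f' => rw [List.filterMap_cons_some h']; exact List.mem_cons_of_mem _ h)
    rw [runExact, runExact_flags_of_not_mem p _ hf']
    cases ins with
    | copyIn d' o l => rfl
    | setBit d' i => rfl
    | add d' a b sh => rfl
    | andBit d' x i y => rfl
    | lt f' a b => exact update_of_ne (fun e => hf (by subst e; simp [Instr.fdest])) _ _
    | fnot f' g => exact update_of_ne (fun e => hf (by subst e; simp [Instr.fdest])) _ _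
    | fand f' g h => exact update_of_ne (fun e => hf (by subst e; simp [Instr.fdest])) _ _
    | forr f' g h => exact update_of_ne (fun e => hf (by subst e; simp [Instr.fdest])) _ _

/-- **Exact semantics of the multiplication macro**: from a state whose block `r₀, …, r₀ + 2Wd` is
clear, `r₀ + 2Wd := x·y` (exactly, when `x < 2^{Wd}`), the other registers and all flags unchanged.
[cite: VedralBarencoEkert1996, §3.3] -/
theorem runExact_mulInstrsUpTo (Wd : ℕ) {r₀ x y : ℕ} (hx : x < r₀) (hy : y < r₀) (st : State)
    (hblock : ∀ j, j ≤ 2 * Wd → st.regs (r₀ + j) = 0) :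
    ∀ i, i ≤ Wd →
      (runExact inp st (mulInstrsUpTo r₀ x y i)).regs (r₀ + 2 * i) = st.regs y * (st.regs x % 2 ^ i) ∧
      (∀ j, 2 * i < j → j ≤ 2 * Wd → (runExact inp st (mulInstrsUpTo r₀ x y i)).regs (r₀ + j) = 0) ∧
      (∀ ρ, ρ < r₀ → (runExact inp st (mulInstrsUpTo r₀ x y i)).regs ρ = st.regs ρ) ∧
      (∀ ρ, r₀ + 2 * Wd < ρ → (runExact inp st (mulInstrsUpTo r₀ x y i)).regs ρ = st.regs ρ) ∧
      (∀ j, 1 ≤ j → j ≤ 2 * i → (runExact inp st (mulInstrsUpTo r₀ x y i)).regs (r₀ + j) ≤ st.regs y * st.regs x) ∧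
      (runExact inp st (mulInstrsUpTo r₀ x y i)).flags = st.flags
  | 0, _ => by
    refine ⟨?_, fun j hj hj' => hblock j hj', fun ρ _ => rfl, fun ρ _ => rfl, fun j h1 h2 => by omega, rfl⟩
    simp only [mulInstrsUpTo, runExact, Nat.add_zero, pow_zero, Nat.mod_one, mul_zero]
    exact hblock 0 (Nat.zero_le _)
  | i + 1, hi => by
    obtain ⟨hacc, hclear, hlow, hhigh, hle, hflags⟩ := runExact_mulInstrsUpTo Wd hx hy st hblock i (by omega)
    set st₁ := runExact inp st (mulInstrsUpTo r₀ x y i) with hst₁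
    rw [mulInstrsUpTo, runExact_append, ← hst₁]
    have hxv : st₁.regs x = st.regs x := hlow x hx
    have hyv : st₁.regs y = st.regs y := hlow y hy
    set P := r₀ + 2 * i + 1 with hP
    set A := r₀ + 2 * i + 2 with hA
    set V := (if (st₁.regs x).testBit i then st₁.regs y else 0) with hV
    have e2 : (runExact inp st₁ [.andBit P x i y, .add A (r₀ + 2 * i) P i]).regs =
        update (update st₁.regs P V) A (update st₁.regs P V (r₀ + 2 * i) + update st₁.regs P V P * 2 ^ i) := rfl
    have ef : (runExact inp st₁ [.andBit P x i y, .add A (r₀ + 2 * i) P i]).flags = st₁.flags := rfl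
    rw [e2, ef]
    have hprod : st.regs y * (st.regs x % 2 ^ i) + V * 2 ^ i = st.regs y * (st.regs x % 2 ^ (i + 1)) := by
      rw [hV, hxv, hyv]; exact mul_mod_two_pow_succ _ _ _
    have hmono : st.regs y * (st.regs x % 2 ^ (i + 1)) ≤ st.regs y * st.regs x :=
      Nat.mul_le_mul_left _ (Nat.mod_le _ _)
    refine ⟨?_, fun j hj hj' => ?_, fun ρ hρ => ?_, fun ρ hρ => ?_, fun j h1 h2 => ?_, hflags⟩
    · rw [show r₀ + 2 * (i + 1) = A by rw [hA]; ring, update_self, update_of_ne (show r₀ + 2 * i ≠ P by omega), update_self,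
        hacc, hprod]
    · rw [update_of_ne (show r₀ + j ≠ A by omega), update_of_ne (show r₀ + j ≠ P by omega)]; exact hclear j (by omega) hj'
    · rw [update_of_ne (show ρ ≠ A by omega), update_of_ne (show ρ ≠ P by omega)]; exact hlow ρ hρ
    · rw [update_of_ne (show ρ ≠ A by omega), update_of_ne (show ρ ≠ P by omega)]; exact hhigh ρ hρ
    · rcases Nat.lt_or_ge j (2 * i + 1) with hj | hj
      · rw [update_of_ne (show r₀ + j ≠ A by omega), update_of_ne (show r₀ + j ≠ P by omega)]; exact hle j h1 (by omega)
      · rcases Nat.lt_or_ge j (2 * i + 2) with hj2 | hj2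
        · rw [show r₀ + j = P by omega, update_of_ne (show P ≠ A by omega), update_self, hV, hxv, hyv]
          split_ifs with ht
          · have hx0 : 0 < st.regs x := Nat.pos_of_ne_zero fun h0 => by
              rw [h0, Nat.zero_testBit] at ht; exact Bool.false_ne_true ht
            exact Nat.le_mul_of_pos_right _ hx0
          · exact Nat.zero_le _
        · rw [show r₀ + j = A by omega, update_self, update_of_ne (show r₀ + 2 * i ≠ P by omega), update_self, hacc, hprod]
          exact hmono

/-- **The exact multiplication macro multiplies** (`x < 2^{Wd}`), bounds every register it writes by
`x·y`, and changes nothing else. [cite: VedralBarencoEkert1996, §3.3] -/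
theorem runExact_mulInstrs (Wd : ℕ) {r₀ x y : ℕ} (hx : x < r₀) (hy : y < r₀) (st : State) (hxW : st.regs x < 2 ^ Wd)
    (hblock : ∀ j, j ≤ 2 * Wd → st.regs (r₀ + j) = 0) :
    (runExact inp st (mulInstrs Wd r₀ x y)).regs (r₀ + 2 * Wd) = st.regs x * st.regs y ∧
      (∀ ρ, ρ < r₀ → (runExact inp st (mulInstrs Wd r₀ x y)).regs ρ = st.regs ρ) ∧
      (∀ ρ, r₀ + 2 * Wd < ρ → (runExact inp st (mulInstrs Wd r₀ x y)).regs ρ = st.regs ρ) ∧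
      (∀ j, j ≤ 2 * Wd → (runExact inp st (mulInstrs Wd r₀ x y)).regs (r₀ + j) ≤ st.regs x * st.regs y) ∧
      (runExact inp st (mulInstrs Wd r₀ x y)).flags = st.flags := by
  obtain ⟨hacc, -, hlow, hhigh, hle, hflags⟩ := runExact_mulInstrsUpTo inp Wd hx hy st hblock Wd le_rfl
  refine ⟨by rw [mulInstrs, hacc, Nat.mod_eq_of_lt hxW, mul_comm], hlow, hhigh, fun j hj => ?_, hflags⟩
  rcases Nat.eq_zero_or_pos j with rfl | hj0
  · rw [mulInstrs, Nat.add_zero, show r₀ = r₀ + 2 * 0 by simp]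
    have h00 := (runExact_mulInstrsUpTo inp Wd hx hy st hblock Wd le_rfl).2.1
    -- `r₀` itself is never written: it still holds `0`
    have : (runExact inp st (mulInstrsUpTo r₀ x y Wd)).regs r₀ = st.regs r₀ :=
      runExact_regs_of_not_mem inp _ _ (by rw [mem_filterMap_rdest_mulInstrsUpTo]; rintro ⟨j, h1, _, h3⟩; omega)
    simp only [Nat.mul_zero, Nat.add_zero]
    rw [this, show r₀ = r₀ + 0 from rfl, hblock 0 (Nat.zero_le _)]; exact Nat.zero_le _
  · rw [mulInstrs, mul_comm]; exact hle j hj0 hj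

end SLP

end Literature.Computability.QuantumComplexity
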